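import Summits.QuantumFields.YangMills.Theorems.BalabanLadderUVOtherGroupsDefs
import Summits.QuantumFields.YangMills.Theorems.BalabanLadderUVRecord13SepCoP
import HarnessLib

/-!
# Route `BalabanLadder`, crux `UVOtherGroups` (stmt-QuantumFields-19356) successors: the v1.5 (`Provisos₁₃SepCoP`) STAGE-13 pinned-record UV packages
# ⇒ `UVD59 N` ∕ the `UVApexSUN` body ∕ `UVSUN` BY NAME

Helper file (`--supports stmt-QuantumFields-19356 --as helper`).  OS-ASSEMBLY BOOKKEEPING (cell `ym-fleet`, director-ym R136 (iii)): filed by the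
UV-station seat ★ym-osasm-p1 (g9) as the `Provisos₁₃SepCoP` TWIN of ★ym-osasm-p2's `Theorems/BalabanLadderUVOtherGroupsApexRecord13Pkg.lean` (‴-keyed,
v1.1 `Provisos₁₃`; itself the twin of `…ApexRecord12Pkg.lean` p470271) — the `SU(N)` seat `ym-osasm-p2` is WAKE-gated (director-ym R236 (c)) and the
owner's R55 (b) put the `UVApexSUN` re-key on «osasm-p2 successor, else owner»; same namespace, NEW decl names (suffix `SepCoP` ∕ `theta20Chain`), p2's
module untouched.  Pure theorems, one line each; 0 `sorry`, 0 `def`, standard axioms; COUNT-NEUTRAL.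

CONTEXT.  Track A (`route-QuantumFields-BalabanUVNodes`) re-keys its four live cruxes at rev 20 to RECORD 13 v1.5 = `Node00/Record13SepCoP.lean`
(node00-def-T FILE 24T p521293; director-ym ★★★ LINE №160∕№162: FINDING №7 ⇒ ONE re-key on the `CoP` edition).  ★osasm-p1 g9 named Track A's rev-20
output ONE LINE BEFORE the Stage-0 projection as two route-independent packages (`Theorems/BalabanLadderUVRecord13SepCoPDefs.lean`):
`Cruxes.UV.Record13SepCoP.UVAtParams13SepCoP N` (θ-keyed) and `UVAtRecord13CSepCoP N` ((D, w)-keyed), with kernels `uvAtParams13SepCoP_of_chain` (the four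
rev-20 item texts with `2 ↦ N`, INLINE) and `stage0_of_uvAtParams13SepCoP` ∕ `stage0_of_uvAtRecord13CSepCoP` whose conclusions are VERBATIM the body of
`YMDAG.UVSplit.UVD59 N` (`Theorems/BalabanLadderUVRecord13SepCoP.lean`).  Those modules import no `Theses` file by design, so they cannot name the `SU(N)`
leaf or the 19356 vocabulary (`Theorems/BalabanLadderUVOtherGroupsDefs.lean`: `UVSUN`, …); THIS file states the junctions BY NAME, for every `N`:

* `uvD59_of_uvAtParams13SepCoP`, `uvD59_of_uvAtRecord13CSepCoP` — package ⇒ `YMDAG.UVSplit.UVD59 N`;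
* `uvD59_of_theta20Chain` — the four rev-20 item texts at `SU(N)` (INLINE, = the hypotheses of `uvAtParams13SepCoP_of_chain`) ⇒ `UVD59 N`: the
  composition of the `UVApexSUN` birth-skeleton candidate re-keyed to rev 20 (desk `pub/ym-fleet/ym-osasm-p1/UVApexSUN-birth-rev20-stubs.COMPOSED.lean`,
  owner R85 registration candidate lineage 89b09208 → 0b9f26ed → c699e049);
* `uvApexSUN_of_uvAtParams13SepCoP`, `uvApexSUN_of_uvAtRecord13CSepCoP` — `∀ N ≥ 3` packages ⇒ the R85 binder body `∀ N ≥ 3, UVD59 N` (`UVApexSUN`,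
  spelling (S0); the (θ)-at-Record-13 spelling `∀ N ≥ 3, UVAtParams13SepCoP N` IMPLIES it);
* `uvSUN_of_uvAtParams13SepCoP`, `uvSUN_of_uvAtRecord13CSepCoP` — `∀ N ≥ 2` packages ⇒ `UVSUN`.

EDIT-SAFETY (R85): no `N = 2` junction to `Theses.BalabanLadder.UV` is stated here (★osasm-p1's tether `Theorems/BalabanLadderUVRecord13SepCoPTether.lean`
and junction scratch J1–J3 carry it) — every conclusion below is `UVD59 N`-valued or the `Theses`-free 19356 vocabulary, so the module survives the R85
edit under either E1 text of `UV`.  HONEST FRAMING: bookkeeping of a CONDITIONAL chain (0∕6 legs); the packages are Bałaban's programme per `SU(N)`,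
OPEN (Track A: typed 28∕28 · discharged 5∕28 at node level, for `N = 2`); not a gap, not Clay.
-/

set_option autoImplicit false

noncomputable section

open Literature.MathematicalPhysics.QuantumFieldTheory.Balaban1983to89
open Literature.MathematicalPhysics.QuantumFieldTheory.Balaban1983to89.T4Continuum
open Summit.QuantumFields.YangMills.Cruxes.UV.Record13SepCoP

namespace Summit.QuantumFields.YangMills.Theorems.UVOtherGroups

section Pkg

variable {N : ℕ} [NeZero N]

/-- **θ-keyed Stage-13 package ⇒ the `SU(N)` leaf `UVD59 N`** (★osasm-p1's `Cruxes.UV.Record13SepCoP.stage0_of_uvAtParams13SepCoP`, by name). -/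
theorem uvD59_of_uvAtParams13SepCoP (h : UVAtParams13SepCoP N) : YMDAG.UVSplit.UVD59 N :=
  fun F => stage0_of_uvAtParams13SepCoP h F

/-- **(D, w)-keyed Stage-13 package ⇒ the `SU(N)` leaf `UVD59 N`** (★osasm-p1's `Cruxes.UV.Record13SepCoP.stage0_of_uvAtRecord13CSepCoP`, by name). -/
theorem uvD59_of_uvAtRecord13CSepCoP (h : UVAtRecord13CSepCoP N) : YMDAG.UVSplit.UVD59 N :=
  fun F => stage0_of_uvAtRecord13CSepCoP h F

/-- **THE REV-20 CHAIN AT `SU(N)` ⇒ `UVD59 N`**: the four rev-20 item texts of `route-QuantumFields-BalabanUVNodes` (v1.5 record `Provisos₁₃SepCoP`) with `2 ↦ N` —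
K0⁵ `Record13SepCoPInhabited` (admissible unity tuples with non-degenerate slots exist) · K1⁵ `StabilityBAtRecordR13SepCoP` ((B) + the non-vacuity window at
some such tuple) · K2⁵ `EndpointGivenBR13SepCoP` (END given (B) + window) · K3⁵ `SpineGivenEndpointR13SepCoP` (the hybrid-NE7 spine given (B) + END) — compose
through ★osasm-p1's `uvAtParams13SepCoP_of_chain` and the Stage-0 projection to the `SU(N)` leaf.  At `N ≥ 3` these four texts are the stubs of the `UVApexSUN`
birth-skeleton candidate re-keyed to rev 20 (desk `pub/ym-fleet/ym-osasm-p1/UVApexSUN-birth-rev20-stubs.COMPOSED.lean`); all four are Bałaban's programme per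
`SU(N)`, OPEN. -/
theorem uvD59_of_theta20Chain
    (h0 : ∀ F : T4Family, ∃ θ : Node00.Stage13Params F N, θ.Provisos₁₃SepCoP F N ∧ (θ.ZtUnity F N ∧ θ.SlotsNondegenerate₁₃ F N) ∧ θ.Admissible F N)
    (h1 : ∀ F : T4Family, (∃ θ : Node00.Stage13Params F N, θ.Provisos₁₃SepCoP F N ∧ (θ.ZtUnity F N ∧ θ.SlotsNondegenerate₁₃ F N) ∧ θ.Admissible F N) →
      ∃ (θ : Node00.Stage13Params F N) (h : θ.Provisos₁₃SepCoP F N), (θ.ZtUnity F N ∧ θ.SlotsNondegenerate₁₃ F N) ∧ θ.Admissible F N ∧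
        B16.EndStatementBPrinted (Node00.datumOfRecord₁₃SepCoP F N θ h).C ∧ ∃ γ₁ : ℝ, 0 < γ₁ ∧ ∀ γ : ℝ, 0 < γ → γ ≤ γ₁ →
          ∃ P : B12.RunParams, 1 ≤ P.K ∧ ((Node00.datumOfRecord₁₃SepCoP F N θ h).C P).flow.InInterval γ P.K)
    (h2 : ∀ (F : T4Family) (θ : Node00.Stage13Params F N) (h : θ.Provisos₁₃SepCoP F N), (θ.ZtUnity F N ∧ θ.SlotsNondegenerate₁₃ F N) → θ.Admissible F N →
      B16.EndStatementBPrinted (Node00.datumOfRecord₁₃SepCoP F N θ h).C → (∃ γ₁ : ℝ, 0 < γ₁ ∧ ∀ γ : ℝ, 0 < γ → γ ≤ γ₁ →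
        ∃ P : B12.RunParams, 1 ≤ P.K ∧ ((Node00.datumOfRecord₁₃SepCoP F N θ h).C P).flow.InInterval γ P.K) →
      DagBinding.EndpointExistence (Node00.datumOfRecord₁₃SepCoP F N θ h).C.toB12)
    (h3 : ∀ (F : T4Family) (θ : Node00.Stage13Params F N) (h : θ.Provisos₁₃SepCoP F N), (θ.ZtUnity F N ∧ θ.SlotsNondegenerate₁₃ F N) → θ.Admissible F N →
      B16.EndStatementBPrinted (Node00.datumOfRecord₁₃SepCoP F N θ h).C → DagBinding.EndpointExistence (Node00.datumOfRecord₁₃SepCoP F N θ h).C.toB12 →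
      T4ApexHybrid.HybridNE7Under (Node00.datumOfRecord₁₃SepCoP F N θ h) (DagBinding.EndpointExistence (Node00.datumOfRecord₁₃SepCoP F N θ h).C.toB12)) :
    YMDAG.UVSplit.UVD59 N :=
  uvD59_of_uvAtParams13SepCoP (uvAtParams13SepCoP_of_chain h0 h1 h2 h3)

end Pkg

/-- **θ-keyed Stage-13 packages (v1.5) for all `N ≥ 3` ⇒ the R85 binder body `UVApexSUN`** (`∀ N ≥ 3, YMDAG.UVSplit.UVD59 N`): spelling (θ) at the
v1.5 Record 13 ⇒ spelling (S0). -/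
theorem uvApexSUN_of_uvAtParams13SepCoP (h : ∀ (N : ℕ) [NeZero N], 3 ≤ N → UVAtParams13SepCoP N) :
    ∀ (N : ℕ) [NeZero N], 3 ≤ N → YMDAG.UVSplit.UVD59 N :=
  fun N _ hN => uvD59_of_uvAtParams13SepCoP (h N hN)

/-- (D, w)-keyed Stage-13 packages for all `N ≥ 3` ⇒ `∀ N ≥ 3, YMDAG.UVSplit.UVD59 N`. -/
theorem uvApexSUN_of_uvAtRecord13CSepCoP (h : ∀ (N : ℕ) [NeZero N], 3 ≤ N → UVAtRecord13CSepCoP N) :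
    ∀ (N : ℕ) [NeZero N], 3 ≤ N → YMDAG.UVSplit.UVD59 N :=
  fun N _ hN => uvD59_of_uvAtRecord13CSepCoP (h N hN)

/-- θ-keyed Stage-13 packages for all `N ≥ 2` ⇒ `UVSUN`. -/
theorem uvSUN_of_uvAtParams13SepCoP (h : ∀ (N : ℕ) [NeZero N], 2 ≤ N → UVAtParams13SepCoP N) : UVSUN :=
  fun N _ hN => uvD59_of_uvAtParams13SepCoP (h N hN)

/-- (D, w)-keyed Stage-13 packages for all `N ≥ 2` ⇒ `UVSUN`. -/
theorem uvSUN_of_uvAtRecord13CSepCoP (h : ∀ (N : ℕ) [NeZero N], 2 ≤ N → UVAtRecord13CSepCoP N) : UVSUN :=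
  fun N _ hN => uvD59_of_uvAtRecord13CSepCoP (h N hN)

end Summit.QuantumFields.YangMills.Theorems.UVOtherGroups

end
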